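import Literature.Geometry.Kaehler.ComplexTorusHodgeClassesMaps
import Literature.Geometry.Kaehler.ComplexTorusOfComplexStructure
import HarnessLib

/-!
# Multiplication by `n` on a complex torus acts as `nᵏ` on `Hᵏ`

Layer A1 of the Hodge foundations lane (`lit-hodgefound`; TRIBUNAL-A §2, block A1, functoriality
check "`[n] : T → T` acts on `Hᵏ` by `nᵏ`"). For the complex torus `X = E/Φ(ℤ^ι)` of the tree
(`Literature.Geometry.Kaehler.ComplexTorus Φ`), multiplication by an integer `n`, `n_X : X → X`, is
the homomorphism `ComplexTorus.mapMatrix Φ Φ (n • 1)` with rational representation `ρᵣ(n_X) = n·1`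
and analytic representation `ρₐ(n_X) = n·id_V` (Lange–Birkenhake, *Complex Abelian Varieties*,
§1.1.2: the representations `ρₐ`, `ρᵣ` are injective ring homomorphisms, so `n_X ↦ n`). Since
`Hᵏ(X, ℂ) ≅ Altᵏ_ℝ(V, ℂ) = ⋀ᵏ Hom_ℝ(V, ℂ)` functorially (§1.1.3 Lemma 1.1.17 / §1.1.4 Prop. 1.1.20;
in the tree `ComplexTorus.cconstClassEquiv` and `ComplexTorus.cmap_cconstClass_mapMatrix`:
`(mapMatrix A)^*[c] = [c ∘ ρₐ(A)]`), the pull-back `n_X^*` acts on `Hᵏ_dR(X; ℂ)` as multiplication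
by `nᵏ`. Everything here is proved:

* `ComplexTorus.mapMatrix_smul_one` — `mapMatrix Φ Φ (n • 1) x = n • x` (`n_X` is `mapMatrix (n•1)`);
* **`ComplexTorus.cmap_mapMatrix_smul_one`** — `n_X^* x = nᵏ • x` for every `x ∈ Hᵏ_dR(X; ℂ)`,
  from the form-level statement `γ ∘ ρₐ(n_X) = nᵏ γ` already in the tree
  (`ComplexTorus.comp_realRep_smul_one`, `ComplexTorus.realRep_smul_one`, file
  `Geometry/Kaehler/ComplexTorusHodgeClassesMaps.lean`, lane seat skel-4) and
  `ComplexTorus.cmap_cconstClass_mapMatrix`.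

## References

* H. Lange, *Abelian Varieties over the Complex Numbers*, Grundlehren Text Editions (2023) — the
  text actually held as `book:lange1992-complex-abelian-varieties` (lane ruling TRIBUNAL-A §5, key of
  record): every "PDF p." locator and every §1.1 theorem number in this file is of THIS edition;
  §1.1.2 (analytic and rational representations), §1.1.3 Lemma 1.1.17, §1.1.4 Prop. 1.1.20 (PDF
  pp. 19, 23–24). [Lange2023AbelianVarietiesComplex]
* H. Lange, Ch. Birkenhake, *Complex Abelian Varieties*, Grundlehren 302 (1992), §1.1 (first
  edition of the same text; "Lange–Birkenhake" in the docstrings below). [LangeBirkenhake1992]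
-/

noncomputable section

open scoped Manifold ContDiff
open Literature.NumberTheory.Transcendental

namespace Literature.Geometry.Kaehler

namespace ComplexTorus

variable {ι : Type*} [Fintype ι] [DecidableEq ι] {E : Type*} [NormedAddCommGroup E]
  [NormedSpace ℂ E] (Φ : (ι → ℝ) ≃L[ℝ] E)

/-- **Multiplication by `n` is the homomorphism of the integer matrix `n · 1`**:
`mapMatrix Φ Φ (n • 1) x = n • x` (`ρᵣ(n_X) = n · 1_{2g}`). [cite: Lange2023AbelianVarietiesComplex, §1.1.2 (PDF p. 19)] -/
theorem mapMatrix_smul_one (n : ℤ) (x : ComplexTorus Φ) :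
    mapMatrix Φ Φ (n • (1 : Matrix ι ι ℤ)) x = n • x := by
  rw [mapMatrix_smul, mapMatrix_one]

variable [FiniteDimensional ℂ E]

/-- **`n_X^*` is multiplication by `nᵏ` on `Hᵏ_dR(X; ℂ)`** for the complex torus `X = E/Φ(ℤ^ι)`:
every class is the class of an invariant form `c` (Prop. 1.1.20, `cconstClassEquiv`), and
`n_X^*[c] = [c ∘ ρₐ(n_X)] = [c ∘ (n · id)] = nᵏ [c]` (Lemma 1.1.17 / Ex. 1.1.6 (7): `Hᵏ = ⋀ᵏ H¹`
functorially, `n_X^* = n` on `H¹ = Hom(Λ, ℤ)`).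
[cite: Lange2023AbelianVarietiesComplex, §1.1.2–§1.1.4, Lemma 1.1.17 and Prop. 1.1.20 (PDF pp. 19, 23–24)] -/
theorem cmap_mapMatrix_smul_one (n : ℤ) (k : ℕ) (x : complexDeRhamCohomology E (ComplexTorus Φ) k) :
    complexDeRhamCohomology.map E
        (contMDiff_real_mapMatrix (Φ := Φ) (Φ' := Φ) (n := ∞) (n • (1 : Matrix ι ι ℤ))) k x =
      ((n : ℂ) ^ k) • x := by
  obtain ⟨c, rfl⟩ := (cconstClassEquiv Φ (k := k)).surjective x
  rw [cconstClassEquiv_apply, cmap_cconstClass_mapMatrix, comp_realRep_smul_one, map_smul]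

end ComplexTorus

end Literature.Geometry.Kaehler

end
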